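import Literature.MathematicalPhysics.QuantumChemistry.SymmetricDeflation
import Summits.Ventures.CertifiedQuantumChemistry.Rows.SingletGapCertificateCodimOne
import HarnessLib

/-!
# Ventures/CertifiedQuantumChemistry — Rows/SingletDeflatorRows.lean: the deflator-side input
# (`hSform` on the SINGLET sector) of the K-restricted level-shift gap producer, for a deflator given
# as an integral-table FILE `S : Model k` with group-balanced tables

HONEST FRAMING (verbatim): certified bounds for a stated model Hamiltonian in a stated basis; not a
claim about the real molecule or material beyond that model.

Typer chem-type-02 (LADDER-CHEM I-TYPE 02c, cell chem-oracle; chem-idea-1 HYPOTHESES-M1OS.md v0.2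
(n1)–(n3)/(G), GO 2026-08-27T02:36:22Z; chem-lead A7 (2), 02:51:22Z). This file is GLUE ONLY: it
instantiates the Literature lemma `deflator_form_le_on_singlet_orth` (`SymmetricDeflation.lean`,
p490591) at a venture model `S : Model k` (rational tables, `Model.hamiltonian S = molecularHamiltonian`
of the cast tables) and states the balance conditions on the RATIONAL tables, so that the conclusion
is LITERALLY the hypothesis `hSform` of chem-type-09's singlet-sector level-shift producer
(`Rows/SingletGapCertificateCodimOne.lean`):
«`∀ x, IsInSector n n x → spinPlus *ᵥ x = 0 → star u ⬝ᵥ x = 0 →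
   (star x ⬝ᵥ S.hamiltonian *ᵥ x).re ≤ ((c : ℚ) : ℝ) * (star x ⬝ᵥ x).re`».

## Contents (no `def`; nothing asserted about any file)
* `Model.deflator_form_le_on_singlet_orth` — weight-family form: `W : X → Fin k → ℝ` balanced by the
  tables of `S` (`S.h p q ≠ 0 → W i p = W i q`, `S.eri p q r s ≠ 0 → W i p + W i r = W i q + W i s`),
  labels `s ↦ (i ↦ Σ_{p∈s↑} W i p + Σ_{p∈s↓} W i p)`, top label `t`, reference vector `u` supported in
  the top class, per-class premises `hoff` (classes `≠ t`) and `htop` (top class, `⊥ u`) ⟹ `hSform`.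
* `Model.deflator_form_le_on_singlet_orth_of_groups` — orbital-GROUP form: `grp : Fin k → X`,
  `S.h p q ≠ 0 → grp p = grp q`, `S.eri p q r s ≠ 0 → (grp p = grp q ∧ grp r = grp s) ∨
  (grp p = grp s ∧ grp r = grp q)` (decidable on literal tables; the local-spin / Hund deflator `G_θ`
  and the sub-Hamiltonian deflator `X` of door M1-OS have this form), labels = the tuple of group
  occupation numbers.
* `Model.deflator_form_le_on_singlet_orth_mem` — the same conclusion in the `singletSector k n`
  (submodule) spelling.
* SUPPLIER ∘ PRODUCER (chem-type-09 2026-08-27T03:20:36Z «type-02 files it»): the three compositions with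
  chem-type-09's `singletGapCertificateCodimOne_of_lowerRow_shift` /
  `…_of_singletLowerRow_shift` (`Rows/SingletGapCertificateCodimOne.lean`, p490432; imported, not
  restated): `Model.singletGapCertificateCodimOne_of_deflator` (weight-family form),
  `Model.singletGapCertificateCodimOne_of_groupDeflator` (group form, sector `LowerRow` leg of the exact
  combined file `Model.lincomb 1 λ F S`), `Model.singletGapCertificateCodimOne_of_groupDeflator_singlet`
  (group form, `SingletLowerRow` leg) — each concluding `SingletGapCertificateCodimOne F n (ℓ − λ·c)`
  («`λ₂(Ĥ_F | K) ≥ ℓ − λc`», HYPOTHESES-M1OS (n1)+(n2)+(n3) ⇒ (G)). c-convention: with the deflator file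
  `S = F_G` as printed take `c` = its off-top level; with `S = F_G − c` (constant folded into `ecore`)
  take `c = 0`; `Model.lincomb 1 λ F S` must be literally the file whose lower row the leg certifies.

The per-class premises are the consumers' exact finite block certificates (replayed reader-side);
they are HYPOTHESES here, as are the table-sparsity conditions (decidable on the literal deflator file).
What is NOT here: the gap-certificate objects and the level-shift algebra (chem-type-09, imported);
the Temple row on `K` (`Rows/SingletTempleRows.lean`); per-block tables (chem-type-06 / chem-idea-1);
claim nodes; any number. References: Horn–Johnson (2013) Cor. 4.3.9 [cite: HornJohnson2013, Cor. 4.3.9];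
Helgaker–Jørgensen–Olsen (2000) Exercise 2.4 (2E.4.3)–(2E.4.5) [cite: HelgakerJorgensenOlsen2000,
Exercise 2.4 eqs. (2E.4.3)–(2E.4.5)].
-/

noncomputable section

namespace Summit.Ventures.CertifiedQuantumChemistry

open Matrix Finset
open Literature.MathematicalPhysics.QuantumLattice Literature.MathematicalPhysics.QuantumChemistry

variable {k : ℕ}

/-- **Deflator-side input of the singlet-sector level-shift producer, weight-family form.** A
deflator FILE `S : Model k` whose rational tables are balanced for a weight family `W` (e.g. the
indicators of an orbital-group partition, `groupIndicator_balanced`) is block diagonal for the joint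
weight label; with `u` supported in the top class `t` and the per-class premises (`hoff` for every class
`≠ t`, `htop` for the top class orthogonally to `u`, both on singlet-sector vectors) its form satisfies
`Re⟨x, Ĥ(S)x⟩ ≤ c‖x‖²` for every singlet-sector `x ⊥ u` — chem-type-09's `hSform` verbatim.
(`Literature…deflator_form_le_on_singlet_orth` at the cast tables; in-house; mechanism Horn–Johnson
Cor. 4.3.9, block structure by HJO Exercise 2.4.) [cite: HornJohnson2013, Cor. 4.3.9] -/
theorem Model.deflator_form_le_on_singlet_orth {X : Type*} [Fintype X] [DecidableEq X]
    (W : X → Fin k → ℝ) (S : Model k)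
    (hh : ∀ i p q, S.h p q ≠ 0 → W i p = W i q)
    (hg : ∀ i p q r s, S.eri p q r s ≠ 0 → W i p + W i r = W i q + W i s)
    (t : X → ℝ) {c : ℚ} {n : ℕ} {u : Fock (Orb (Fin k))}
    (huT : ∀ s, (fun i => ∑ p ∈ upPart s, W i p + ∑ p ∈ downPart s, W i p) ≠ t → u s = 0)
    (hoff : ∀ l, l ≠ t → ∀ z : Fock (Orb (Fin k)), IsInSector n n z → spinPlus *ᵥ z = 0 →
      (∀ s, (fun i => ∑ p ∈ upPart s, W i p + ∑ p ∈ downPart s, W i p) ≠ l → z s = 0) →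
      (star z ⬝ᵥ S.hamiltonian *ᵥ z).re ≤ ((c : ℚ) : ℝ) * (star z ⬝ᵥ z).re)
    (htop : ∀ y : Fock (Orb (Fin k)), IsInSector n n y → spinPlus *ᵥ y = 0 →
      (∀ s, (fun i => ∑ p ∈ upPart s, W i p + ∑ p ∈ downPart s, W i p) ≠ t → y s = 0) →
      star u ⬝ᵥ y = 0 →
      (star y ⬝ᵥ S.hamiltonian *ᵥ y).re ≤ ((c : ℚ) : ℝ) * (star y ⬝ᵥ y).re) :
    ∀ x : Fock (Orb (Fin k)), IsInSector n n x → spinPlus *ᵥ x = 0 → star u ⬝ᵥ x = 0 →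
      (star x ⬝ᵥ S.hamiltonian *ᵥ x).re ≤ ((c : ℚ) : ℝ) * (star x ⬝ᵥ x).re :=
  Literature.MathematicalPhysics.QuantumChemistry.deflator_form_le_on_singlet_orth W
    (fun p q => (S.h p q : ℂ)) (fun p q r s => (S.eri p q r s : ℂ))
    (S.ecore : ℂ) (fun i p q hpq => hh i p q fun h0 => hpq (by rw [h0, Rat.cast_zero]))
    (fun i p q r s hpqrs => hg i p q r s fun h0 => hpqrs (by rw [h0, Rat.cast_zero])) t huT hoff htop

/-- **Orbital-GROUP form.** `grp : Fin k → X` a partition label; the file's tables are group-local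
(`h_pq ≠ 0 ⇒ p ~ q`; `(pq|rs) ≠ 0 ⇒ (p ~ q ∧ r ~ s) ∨ (p ~ s ∧ r ~ q)` — decidable on literal tables);
labels = the tuple of group occupation numbers `i ↦ N_i(s)` (as reals); top tuple `t`; reference CSF `u`;
per-class premises as above ⟹ `hSform` on the singlet sector. (`groupIndicator_balanced` + the
weight-family form.) [cite: HelgakerJorgensenOlsen2000, Exercise 2.4 eqs. (2E.4.3)–(2E.4.5)] -/
theorem Model.deflator_form_le_on_singlet_orth_of_groups {X : Type*} [Fintype X] [DecidableEq X]
    (grp : Fin k → X) (S : Model k)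
    (hh : ∀ p q, S.h p q ≠ 0 → grp p = grp q)
    (hg : ∀ p q r s, S.eri p q r s ≠ 0 →
      (grp p = grp q ∧ grp r = grp s) ∨ (grp p = grp s ∧ grp r = grp q))
    (t : X → ℝ) {c : ℚ} {n : ℕ} {u : Fock (Orb (Fin k))}
    (huT : ∀ s, (fun i => ∑ p ∈ upPart s, (if grp p = i then (1 : ℝ) else 0) +
      ∑ p ∈ downPart s, (if grp p = i then (1 : ℝ) else 0)) ≠ t → u s = 0)
    (hoff : ∀ l, l ≠ t → ∀ z : Fock (Orb (Fin k)), IsInSector n n z → spinPlus *ᵥ z = 0 →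
      (∀ s, (fun i => ∑ p ∈ upPart s, (if grp p = i then (1 : ℝ) else 0) +
        ∑ p ∈ downPart s, (if grp p = i then (1 : ℝ) else 0)) ≠ l → z s = 0) →
      (star z ⬝ᵥ S.hamiltonian *ᵥ z).re ≤ ((c : ℚ) : ℝ) * (star z ⬝ᵥ z).re)
    (htop : ∀ y : Fock (Orb (Fin k)), IsInSector n n y → spinPlus *ᵥ y = 0 →
      (∀ s, (fun i => ∑ p ∈ upPart s, (if grp p = i then (1 : ℝ) else 0) +
        ∑ p ∈ downPart s, (if grp p = i then (1 : ℝ) else 0)) ≠ t → y s = 0) →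
      star u ⬝ᵥ y = 0 →
      (star y ⬝ᵥ S.hamiltonian *ᵥ y).re ≤ ((c : ℚ) : ℝ) * (star y ⬝ᵥ y).re) :
    ∀ x : Fock (Orb (Fin k)), IsInSector n n x → spinPlus *ᵥ x = 0 → star u ⬝ᵥ x = 0 →
      (star x ⬝ᵥ S.hamiltonian *ᵥ x).re ≤ ((c : ℚ) : ℝ) * (star x ⬝ᵥ x).re := by
  have hb := groupIndicator_balanced grp
    (h := fun p q => (S.h p q : ℂ)) (g := fun p q r s => (S.eri p q r s : ℂ))
    (fun p q hpq => hh p q fun h0 => hpq (by simp only [h0, Rat.cast_zero]))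
    (fun p q r s hpqrs => hg p q r s fun h0 => hpqrs (by simp only [h0, Rat.cast_zero]))
  exact Literature.MathematicalPhysics.QuantumChemistry.deflator_form_le_on_singlet_orth
    (fun i p => if grp p = i then (1 : ℝ) else 0)
    (fun p q => (S.h p q : ℂ)) (fun p q r s => (S.eri p q r s : ℂ)) (S.ecore : ℂ) hb.1 hb.2 t huT hoff htop

/-- The same conclusion in the SUBMODULE spelling `x ∈ singletSector k n` (`Statement.lean`;
`mem_singletSector_iff`, `mem_szSector_iff_isInSector`). [cite: HornJohnson2013, Cor. 4.3.9] -/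
theorem Model.deflator_form_le_on_singlet_orth_mem {X : Type*} [Fintype X] [DecidableEq X] (W : X → Fin k → ℝ) (S : Model k)
    (hh : ∀ i p q, S.h p q ≠ 0 → W i p = W i q)
    (hg : ∀ i p q r s, S.eri p q r s ≠ 0 → W i p + W i r = W i q + W i s)
    (t : X → ℝ) {c : ℚ} {n : ℕ} {u : Fock (Orb (Fin k))}
    (huT : ∀ s, (fun i => ∑ p ∈ upPart s, W i p + ∑ p ∈ downPart s, W i p) ≠ t → u s = 0)
    (hoff : ∀ l, l ≠ t → ∀ z : Fock (Orb (Fin k)), IsInSector n n z → spinPlus *ᵥ z = 0 →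
      (∀ s, (fun i => ∑ p ∈ upPart s, W i p + ∑ p ∈ downPart s, W i p) ≠ l → z s = 0) →
      (star z ⬝ᵥ S.hamiltonian *ᵥ z).re ≤ ((c : ℚ) : ℝ) * (star z ⬝ᵥ z).re)
    (htop : ∀ y : Fock (Orb (Fin k)), IsInSector n n y → spinPlus *ᵥ y = 0 →
      (∀ s, (fun i => ∑ p ∈ upPart s, W i p + ∑ p ∈ downPart s, W i p) ≠ t → y s = 0) →
      star u ⬝ᵥ y = 0 →
      (star y ⬝ᵥ S.hamiltonian *ᵥ y).re ≤ ((c : ℚ) : ℝ) * (star y ⬝ᵥ y).re) :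
    ∀ x ∈ singletSector k n, star u ⬝ᵥ x = 0 →
      (star x ⬝ᵥ S.hamiltonian *ᵥ x).re ≤ ((c : ℚ) : ℝ) * (star x ⬝ᵥ x).re := by
  intro x hx hux
  obtain ⟨hx1, hx2⟩ := (mem_singletSector_iff x).1 hx
  exact Model.deflator_form_le_on_singlet_orth W S hh hg t huT hoff htop x
    ((mem_szSector_iff_isInSector n n x).1 hx1) hx2 hux

/-! ## Supplier ∘ producer: the singlet-sector gap certificate from a group-balanced deflator file -/

/-- **(n1)+(n2)+(n3) ⇒ (G), weight-family form.** Symmetric `F` (the file) and `S` (the deflator file,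
`W`-balanced tables), `0 ≤ λ`, reference vector `u` supported in the top class `t`, the per-class
premises `hoff`/`htop` at level `c`, and an ORDINARY certified sector lower row
`ℓ ≤ E₀(Ĥ(F + λS); n, n)` of the exact combined file `Model.lincomb 1 λ F S` give
`SingletGapCertificateCodimOne F n (ℓ − λc)` («`λ₂(Ĥ_F | (n,n)-sector ∩ ker Ŝ₊) ≥ ℓ − λc` counting
multiplicity»). Composition of `Model.deflator_form_le_on_singlet_orth` with chem-type-09's
`singletGapCertificateCodimOne_of_lowerRow_shift` (nothing of either restated).
[cite: HornJohnson2013, Cor. 4.3.9] -/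
theorem Model.singletGapCertificateCodimOne_of_deflator {X : Type*} [Fintype X] [DecidableEq X]
    (W : X → Fin k → ℝ) {F S : Model k} (hF : F.IsSymmetric) (hS : S.IsSymmetric)
    (hh : ∀ i p q, S.h p q ≠ 0 → W i p = W i q)
    (hg : ∀ i p q r s, S.eri p q r s ≠ 0 → W i p + W i r = W i q + W i s)
    (t : X → ℝ) {c : ℚ} {n : ℕ} {u : Fock (Orb (Fin k))}
    (huT : ∀ s, (fun i => ∑ p ∈ upPart s, W i p + ∑ p ∈ downPart s, W i p) ≠ t → u s = 0)
    (hoff : ∀ l, l ≠ t → ∀ z : Fock (Orb (Fin k)), IsInSector n n z → spinPlus *ᵥ z = 0 →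
      (∀ s, (fun i => ∑ p ∈ upPart s, W i p + ∑ p ∈ downPart s, W i p) ≠ l → z s = 0) →
      (star z ⬝ᵥ S.hamiltonian *ᵥ z).re ≤ ((c : ℚ) : ℝ) * (star z ⬝ᵥ z).re)
    (htop : ∀ y : Fock (Orb (Fin k)), IsInSector n n y → spinPlus *ᵥ y = 0 →
      (∀ s, (fun i => ∑ p ∈ upPart s, W i p + ∑ p ∈ downPart s, W i p) ≠ t → y s = 0) →
      star u ⬝ᵥ y = 0 →
      (star y ⬝ᵥ S.hamiltonian *ᵥ y).re ≤ ((c : ℚ) : ℝ) * (star y ⬝ᵥ y).re)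
    {lam : ℚ} (hlam : 0 ≤ lam) {ℓ : ℚ} (hL : LowerRow (Model.lincomb 1 lam F S) n n ℓ) :
    SingletGapCertificateCodimOne F n (ℓ - lam * c) :=
  singletGapCertificateCodimOne_of_lowerRow_shift hF hS hlam u
    (Model.deflator_form_le_on_singlet_orth W S hh hg t huT hoff htop) hL

/-- **(n1)+(n2)+(n3) ⇒ (G), orbital-group form** (the local-spin / Hund block deflator `G_θ` and the
sub-Hamiltonian deflator `X` of door M1-OS): `grp : Fin k → X` a partition, the deflator file's
tables group-local, labels = the tuple of group occupation numbers, top tuple `t`, reference CSF `u`,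
per-class premises at level `c`, sector lower row `ℓ` of `Model.lincomb 1 λ F S`, `0 ≤ λ` ⇒
`SingletGapCertificateCodimOne F n (ℓ − λc)`. [cite: HornJohnson2013, Cor. 4.3.9] -/
theorem Model.singletGapCertificateCodimOne_of_groupDeflator {X : Type*} [Fintype X] [DecidableEq X]
    (grp : Fin k → X) {F S : Model k} (hF : F.IsSymmetric) (hS : S.IsSymmetric)
    (hh : ∀ p q, S.h p q ≠ 0 → grp p = grp q)
    (hg : ∀ p q r s, S.eri p q r s ≠ 0 →
      (grp p = grp q ∧ grp r = grp s) ∨ (grp p = grp s ∧ grp r = grp q))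
    (t : X → ℝ) {c : ℚ} {n : ℕ} {u : Fock (Orb (Fin k))}
    (huT : ∀ s, (fun i => ∑ p ∈ upPart s, (if grp p = i then (1 : ℝ) else 0) +
      ∑ p ∈ downPart s, (if grp p = i then (1 : ℝ) else 0)) ≠ t → u s = 0)
    (hoff : ∀ l, l ≠ t → ∀ z : Fock (Orb (Fin k)), IsInSector n n z → spinPlus *ᵥ z = 0 →
      (∀ s, (fun i => ∑ p ∈ upPart s, (if grp p = i then (1 : ℝ) else 0) +
        ∑ p ∈ downPart s, (if grp p = i then (1 : ℝ) else 0)) ≠ l → z s = 0) →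
      (star z ⬝ᵥ S.hamiltonian *ᵥ z).re ≤ ((c : ℚ) : ℝ) * (star z ⬝ᵥ z).re)
    (htop : ∀ y : Fock (Orb (Fin k)), IsInSector n n y → spinPlus *ᵥ y = 0 →
      (∀ s, (fun i => ∑ p ∈ upPart s, (if grp p = i then (1 : ℝ) else 0) +
        ∑ p ∈ downPart s, (if grp p = i then (1 : ℝ) else 0)) ≠ t → y s = 0) →
      star u ⬝ᵥ y = 0 →
      (star y ⬝ᵥ S.hamiltonian *ᵥ y).re ≤ ((c : ℚ) : ℝ) * (star y ⬝ᵥ y).re)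
    {lam : ℚ} (hlam : 0 ≤ lam) {ℓ : ℚ} (hL : LowerRow (Model.lincomb 1 lam F S) n n ℓ) :
    SingletGapCertificateCodimOne F n (ℓ - lam * c) :=
  singletGapCertificateCodimOne_of_lowerRow_shift hF hS hlam u
    (Model.deflator_form_le_on_singlet_orth_of_groups grp S hh hg t huT hoff htop) hL

/-- Orbital-group form with the SINGLET lower row of the combined file as the leg (the `:s2=0` leg
kind; chem-type-09's `singletGapCertificateCodimOne_of_singletLowerRow_shift`).
[cite: HornJohnson2013, Cor. 4.3.9] -/
theorem Model.singletGapCertificateCodimOne_of_groupDeflator_singlet {X : Type*} [Fintype X]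
    [DecidableEq X] (grp : Fin k → X) {F S : Model k} (hF : F.IsSymmetric) (hS : S.IsSymmetric)
    (hh : ∀ p q, S.h p q ≠ 0 → grp p = grp q)
    (hg : ∀ p q r s, S.eri p q r s ≠ 0 →
      (grp p = grp q ∧ grp r = grp s) ∨ (grp p = grp s ∧ grp r = grp q))
    (t : X → ℝ) {c : ℚ} {n : ℕ} {u : Fock (Orb (Fin k))}
    (huT : ∀ s, (fun i => ∑ p ∈ upPart s, (if grp p = i then (1 : ℝ) else 0) +
      ∑ p ∈ downPart s, (if grp p = i then (1 : ℝ) else 0)) ≠ t → u s = 0)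
    (hoff : ∀ l, l ≠ t → ∀ z : Fock (Orb (Fin k)), IsInSector n n z → spinPlus *ᵥ z = 0 →
      (∀ s, (fun i => ∑ p ∈ upPart s, (if grp p = i then (1 : ℝ) else 0) +
        ∑ p ∈ downPart s, (if grp p = i then (1 : ℝ) else 0)) ≠ l → z s = 0) →
      (star z ⬝ᵥ S.hamiltonian *ᵥ z).re ≤ ((c : ℚ) : ℝ) * (star z ⬝ᵥ z).re)
    (htop : ∀ y : Fock (Orb (Fin k)), IsInSector n n y → spinPlus *ᵥ y = 0 →
      (∀ s, (fun i => ∑ p ∈ upPart s, (if grp p = i then (1 : ℝ) else 0) +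
        ∑ p ∈ downPart s, (if grp p = i then (1 : ℝ) else 0)) ≠ t → y s = 0) →
      star u ⬝ᵥ y = 0 →
      (star y ⬝ᵥ S.hamiltonian *ᵥ y).re ≤ ((c : ℚ) : ℝ) * (star y ⬝ᵥ y).re)
    {lam : ℚ} (hlam : 0 ≤ lam) {ℓ : ℚ} (hL : SingletLowerRow (Model.lincomb 1 lam F S) n ℓ) :
    SingletGapCertificateCodimOne F n (ℓ - lam * c) :=
  singletGapCertificateCodimOne_of_singletLowerRow_shift hF hS hlam u
    (Model.deflator_form_le_on_singlet_orth_of_groups grp S hh hg t huT hoff htop) hL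

end Summit.Ventures.CertifiedQuantumChemistry

end
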